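import Summits.CriticalPhenomena.CardyFormulaZ2.Theses.CardySelfRefinement
import Literature.Probability.Percolation.QuadCrossingSpaceZ2
import Literature.Probability.Percolation.QuadCrossingNullFrontier
import Literature.Probability.Percolation.QuadCrossingNoiseDiscrete
import Literature.Probability.Percolation.QuadCrossingSubseqLimits
import Literature.Probability.Percolation.QuadCrossingLowerSets
import HarnessLib

/-!
# `LagsToInvariance` (route CardySelfRefinement, item stmt-CriticalPhenomena-10273)

Schramm–Smirnov bookkeeping: if the full-plane quad-crossing laws of critical bond percolation on
`ℤ²` at meshes `kη` and `η` (`k = 2, 3`) give asymptotically the same probability to every joint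
crossing event of finitely many quads (the route's `LatticeLags`, read through `ExactEndpoints`),
then every subsequential scaling limit `μ ∈ subseqQuadLimits univ` is `S_2`- and `S_3`-invariant
(`dilateLaw k μ = μ`).

Proof (no compactness needed).  Let `μ = lim μ_{δ_n}` in `FiniteMeasure ℋ_ℂ`.
* `dilateLaw k μ_δ = μ_{kδ}` exactly (`dilateLaw_z2QuadLaw`, `squareCrossingLaw_eq_z2QuadLaw`),
  and push-forward by the homeomorphism `S_k` of `ℋ_ℂ` is weakly continuous
  (`FiniteMeasure.tendsto_map_of_tendsto_of_continuous`), so `ν := dilateLaw k μ = lim μ_{kδ_n}`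
  along the SAME sequence; both `μ`, `ν` are probability measures
  (`isProbabilityMeasure_of_isSubseqQuadLimit`).
* The quads `Q` with `(μ + ν)(∂⊞_Q) = 0` are dense in `𝒬_ℂ`
  (`Quad.dense_setOf_measure_frontier_crossedEvent_eq_zero`, the soft half of SS11 Lemma 5.1,
  valid for every finite measure); finite intersections of their crossing events form a
  `π`-system generating the Borel `σ`-field (SS11 Thm. 1.4 (2),
  `QuadConfig.generateFrom_notCrossed_eq_borel_of_esb`), and on each such event the portmanteau
  theorem (`tendsto_measure_of_null_frontier_generateFrom`, SS11 Cor. 5.2) and the lag hypothesis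
  give `μ = ν`; `ext_of_generate_finite` concludes.
* `ExactEndpoints` transfers the route's lag statement (phrased with the interpolating laws
  `M_k(1,0)`, `M_k(0,½)` and preimages under `configOf`) to the laws `squareCrossingLaw`: the
  a.e.-measurability of `configOf` under `M_k` needed for `Measure.map_apply` is forced by the
  equality of push-forwards itself (a non-a.e.-measurable push-forward is `0`, while the bond side
  is a probability measure).
-/

noncomputable section

open MeasureTheory Filter Set Topology
open scoped unitInterval
open Literature.Probability.Percolation Literature.Probability.LatticeModels
open Literature.Probability.Percolation.QuadCrossing
open Summit.CriticalPhenomena.CardyFormulaZ2.Theses.CardySelfRefinement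

namespace Summit.CriticalPhenomena.CardyFormulaZ2.Theorems

/-! ### The full-plane laws `squareCrossingLaw univ δ` -/

/-- `squareCrossingLaw univ δ` is a probability measure for `δ > 0` (it is `μ_{δ√2}`,
`squareCrossingLaw_eq_z2QuadLaw`, and `isProbabilityMeasure_z2QuadLaw_of_pos`). -/
theorem isProbabilityMeasure_squareCrossingLaw_univ {δ : ℝ} (hδ : 0 < δ) :
    IsProbabilityMeasure
      (squareCrossingLaw (univ : Set ℂ) δ : Measure (QuadConfig (univ : Set ℂ))) := by
  rw [squareCrossingLaw_eq_z2QuadLaw]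
  exact isProbabilityMeasure_z2QuadLaw_of_pos isOpen_univ
    (mul_pos hδ (Real.sqrt_pos.mpr (by norm_num)))

/-- As a measure, `squareCrossingLaw univ δ` is the push-forward of `P_{1/2}` under
`configOf squareLatticeEmbedding.z δ univ` (definitional). -/
theorem toMeasure_squareCrossingLaw (δ : ℝ) :
    (squareCrossingLaw (univ : Set ℂ) δ : Measure (QuadConfig (univ : Set ℂ))) =
      (bondPercolation (zdGraph 2) half).map
        (configOf squareLatticeEmbedding.z δ (univ : Set ℂ)) := rfl

/-- Dilating the law at mesh `δ` by `t ≠ 0` gives the law at mesh `tδ`: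
`dilateLaw t (squareCrossingLaw univ δ) = squareCrossingLaw univ (tδ)` (from
`dilateLaw_z2QuadLaw`). -/
theorem dilateLaw_squareCrossingLaw {t : ℝ} (ht : t ≠ 0) (δ : ℝ) :
    dilateLaw t ht (squareCrossingLaw (univ : Set ℂ) δ) = squareCrossingLaw univ (t * δ) := by
  rw [squareCrossingLaw_eq_z2QuadLaw, squareCrossingLaw_eq_z2QuadLaw, dilateLaw_z2QuadLaw,
    mul_assoc]

/-- **Transfer through an equality of push-forwards.**  If the push-forward of a law `M` on bond
configurations under `configOf … η` equals the bond-`ℤ²` quad law at a positive mesh `t`, then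
`configOf … η` is a.e.-measurable for `M` (else the left side would be the zero measure while the
right side is a probability measure), so the `M`-mass of the preimage of a Borel set `S` is the
`squareCrossingLaw univ t`-mass of `S`. -/
theorem measureReal_preimage_configOf_eq_of_map_eq {M : Measure (BondConfig (Site 2))} {η t : ℝ}
    (ht : 0 < t)
    (h : M.map (configOf squareLatticeEmbedding.z η (univ : Set ℂ)) =
      (bondPercolation (zdGraph 2) half).map
        (configOf squareLatticeEmbedding.z t (univ : Set ℂ)))
    {S : Set (QuadConfig (univ : Set ℂ))} (hS : MeasurableSet S) :
    M.real (configOf squareLatticeEmbedding.z η (univ : Set ℂ) ⁻¹' S) =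
      (squareCrossingLaw (univ : Set ℂ) t : Measure (QuadConfig (univ : Set ℂ))).real S := by
  haveI := isProbabilityMeasure_squareCrossingLaw_univ ht
  have hae : AEMeasurable (configOf squareLatticeEmbedding.z η (univ : Set ℂ)) M := by
    by_contra hna
    have h0 : (squareCrossingLaw (univ : Set ℂ) t : Measure (QuadConfig (univ : Set ℂ))) = 0 := by
      rw [toMeasure_squareCrossingLaw, ← h, Measure.map_of_not_aemeasurable hna]
    exact (IsProbabilityMeasure.ne_zero
      (squareCrossingLaw (univ : Set ℂ) t : Measure (QuadConfig (univ : Set ℂ)))) h0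
  rw [measureReal_def, measureReal_def, ← Measure.map_apply_of_aemeasurable hae hS, h]
  rfl

/-! ### Joint crossing events of finite quad families -/

/-- The joint crossing event `{S : ∀ i, G i ∈ S}` of a finite family of quads is closed, hence
Borel. -/
theorem measurableSet_setOf_forall_mem {m : ℕ} (G : Fin m → Quad (univ : Set ℂ)) :
    MeasurableSet {S : QuadConfig (univ : Set ℂ) | ∀ i, G i ∈ S} := by
  have : {S : QuadConfig (univ : Set ℂ) | ∀ i, G i ∈ S} = ⋂ i, QuadConfig.crossedEvent (G i) := by
    ext S; simp [QuadConfig.crossedEvent]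
  rw [this]
  exact (isClosed_iInter fun i => QuadConfig.isClosed_crossedEvent (G i)).measurableSet

/-- The joint crossing event of a finite family is measurable with respect to the `σ`-field
generated by the crossing events of its members. -/
theorem measurableSet_generateFrom_setOf_forall_mem {m : ℕ} (G : Fin m → Quad (univ : Set ℂ)) :
    MeasurableSet[MeasurableSpace.generateFrom
      ((fun Q => QuadConfig.crossedEvent Q) '' range G)]
      {S : QuadConfig (univ : Set ℂ) | ∀ i, G i ∈ S} := by
  have : {S : QuadConfig (univ : Set ℂ) | ∀ i, G i ∈ S} = ⋂ i, QuadConfig.crossedEvent (G i) := by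
    ext S; simp [QuadConfig.crossedEvent]
  rw [this]
  exact @MeasurableSet.iInter _ _ (MeasurableSpace.generateFrom
      ((fun Q => QuadConfig.crossedEvent Q) '' range G)) _ _ fun i =>
    MeasurableSpace.measurableSet_generateFrom ⟨G i, mem_range_self i, rfl⟩

/-- Concatenating two finite families intersects their joint crossing events. -/
theorem setOf_forall_mem_append {m n : ℕ} (G : Fin m → Quad (univ : Set ℂ))
    (G' : Fin n → Quad (univ : Set ℂ)) :
    {S : QuadConfig (univ : Set ℂ) | ∀ i, Fin.append G G' i ∈ S} =
      {S | ∀ i, G i ∈ S} ∩ {S | ∀ i, G' i ∈ S} := by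
  ext S
  simp only [mem_setOf_eq, mem_inter_iff]
  constructor
  · intro h
    exact ⟨fun i => by simpa using h (Fin.castAdd n i), fun i => by simpa using h (Fin.natAdd m i)⟩
  · rintro ⟨h1, h2⟩ i
    refine Fin.addCases (fun i => ?_) (fun i => ?_) i
    · simpa using h1 i
    · simpa using h2 i

/-! ### The soft identification of the two limits -/

/-- **Two lags merge the limits.**  Let `k > 0`.  If for every finite family of quads the
joint crossing probabilities under the bond-`ℤ²` laws at meshes `kη` and `η` differ by `o(1)` as
`η → 0⁺`, then every subsequential scaling limit `μ` satisfies `dilateLaw k μ = μ`.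
Schramm–Smirnov: `dilateLaw k μ_δ = μ_{kδ}`, `S_k` acts continuously on laws, continuity quads of
`μ + S_kμ` are dense (soft Lemma 5.1), their finite joint crossing events are a generating
`π`-system of continuity sets (Thm. 1.4 (2), Cor. 5.2). -/
theorem dilateLaw_eq_self_of_lags {k : ℝ} (hk : 0 < k)
    (hdiff : ∀ (m : ℕ) (G : Fin m → Quad (univ : Set ℂ)),
      Tendsto (fun η : ℝ =>
        (squareCrossingLaw (univ : Set ℂ) (k * η) : Measure (QuadConfig (univ : Set ℂ))).real
            {S | ∀ i, G i ∈ S} -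
          (squareCrossingLaw (univ : Set ℂ) η : Measure (QuadConfig (univ : Set ℂ))).real
            {S | ∀ i, G i ∈ S}) (𝓝[>] 0) (𝓝 0))
    {μ : FiniteMeasure (QuadConfig (univ : Set ℂ))} (hμ : μ ∈ subseqQuadLimits (univ : Set ℂ)) :
    dilateLaw k hk.ne' μ = μ := by
  obtain ⟨δs, hpos, hδ0, hconv⟩ := hμ
  set ν : FiniteMeasure (QuadConfig (univ : Set ℂ)) := dilateLaw k hk.ne' μ with hν_def
  -- `ν` is the limit of the laws at meshes `k δ_n`
  have hconvν : Tendsto (fun n => squareCrossingLaw (univ : Set ℂ) (k * δs n)) atTop (𝓝 ν) := by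
    have h := FiniteMeasure.tendsto_map_of_tendsto_of_continuous _ _ hconv
      (QuadConfig.continuous_mapHomeomorph
        (Homeomorph.mulLeft₀ (k : ℂ) (Complex.ofReal_ne_zero.mpr hk.ne')))
    have hfun : (fun n => (squareCrossingLaw (univ : Set ℂ) (δs n)).map
        (QuadConfig.mapHomeomorph
          (Homeomorph.mulLeft₀ (k : ℂ) (Complex.ofReal_ne_zero.mpr hk.ne')))) =
        fun n => squareCrossingLaw (univ : Set ℂ) (k * δs n) :=
      funext fun n => dilateLaw_squareCrossingLaw hk.ne' (δs n)
    rw [hfun] at h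
    exact h
  have hνmem : ν ∈ subseqQuadLimits (univ : Set ℂ) :=
    ⟨fun n => k * δs n, fun n => mul_pos hk (hpos n), by simpa using hδ0.const_mul k, hconvν⟩
  haveI hμP : IsProbabilityMeasure (μ : Measure (QuadConfig (univ : Set ℂ))) :=
    isProbabilityMeasure_of_isSubseqQuadLimit isOpen_univ ⟨δs, hpos, hδ0, hconv⟩
  haveI hνP : IsProbabilityMeasure (ν : Measure (QuadConfig (univ : Set ℂ))) :=
    isProbabilityMeasure_of_isSubseqQuadLimit isOpen_univ hνmem
  -- continuity quads for `μ + ν`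
  set ρ : Measure (QuadConfig (univ : Set ℂ)) :=
    (μ : Measure (QuadConfig (univ : Set ℂ))) + (ν : Measure (QuadConfig (univ : Set ℂ))) with hρ
  set A : Set (Quad (univ : Set ℂ)) := {Q | ρ (frontier (QuadConfig.crossedEvent Q)) = 0} with hA
  have hAdense : Dense A := Quad.dense_setOf_measure_frontier_crossedEvent_eq_zero isOpen_univ ρ
  have hAμ : ∀ Q ∈ A,
      (μ : Measure (QuadConfig (univ : Set ℂ))) (frontier (QuadConfig.crossedEvent Q)) = 0 := by
    intro Q hQ
    have hle : (μ : Measure (QuadConfig (univ : Set ℂ))) (frontier (QuadConfig.crossedEvent Q)) ≤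
        ρ (frontier (QuadConfig.crossedEvent Q)) := by
      rw [hρ, Measure.add_apply]; exact le_self_add
    exact nonpos_iff_eq_zero.mp (hle.trans_eq hQ)
  have hAν : ∀ Q ∈ A,
      (ν : Measure (QuadConfig (univ : Set ℂ))) (frontier (QuadConfig.crossedEvent Q)) = 0 := by
    intro Q hQ
    have hle : (ν : Measure (QuadConfig (univ : Set ℂ))) (frontier (QuadConfig.crossedEvent Q)) ≤
        ρ (frontier (QuadConfig.crossedEvent Q)) := by
      rw [hρ, Measure.add_apply]; exact le_add_self
    exact nonpos_iff_eq_zero.mp (hle.trans_eq hQ)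
  -- the generating π-system of joint crossing events of continuity quads
  set C : Set (Set (QuadConfig (univ : Set ℂ))) :=
    {E | ∃ (m : ℕ) (G : Fin m → Quad (univ : Set ℂ)), (∀ i, G i ∈ A) ∧ E = {S | ∀ i, G i ∈ S}}
    with hC
  have hCpi : IsPiSystem C := by
    rintro _ ⟨m, G, hG, rfl⟩ _ ⟨n, G', hG', rfl⟩ _
    refine ⟨m + n, Fin.append G G', fun i => ?_, (setOf_forall_mem_append G G').symm⟩
    refine Fin.addCases (fun i => ?_) (fun i => ?_) i
    · simpa using hG i
    · simpa using hG' i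
  have hgen : (QuadConfig.instMeasurableSpace : MeasurableSpace (QuadConfig (univ : Set ℂ))) =
      MeasurableSpace.generateFrom C := by
    have hb : (QuadConfig.instMeasurableSpace : MeasurableSpace (QuadConfig (univ : Set ℂ))) =
        borel (QuadConfig (univ : Set ℂ)) := rfl
    have h14 := QuadConfig.generateFrom_notCrossed_eq_borel_of_esb
      (fun Q => Quad.mem_closure_setOf_strictlyDominated isOpen_univ Q) hAdense
    refine le_antisymm ?_ ?_
    · rw [hb, ← h14]
      refine MeasurableSpace.generateFrom_le ?_
      rintro _ ⟨Q, hQ, rfl⟩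
      dsimp only
      rw [← QuadConfig.compl_crossedEvent]
      refine MeasurableSet.compl
        (MeasurableSpace.measurableSet_generateFrom ⟨1, fun _ => Q, ?_, ?_⟩)
      · exact fun _ => hQ
      · ext S; simp [QuadConfig.crossedEvent]
    · refine MeasurableSpace.generateFrom_le ?_
      rintro _ ⟨m, G, -, rfl⟩
      exact measurableSet_setOf_forall_mem G
  -- the two limits agree on the π-system
  have hδs : Tendsto δs atTop (𝓝[>] 0) :=
    tendsto_nhdsWithin_iff.mpr ⟨hδ0, Eventually.of_forall fun n => hpos n⟩
  have hagree : ∀ E ∈ C, (ν : Measure (QuadConfig (univ : Set ℂ))) E =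
      (μ : Measure (QuadConfig (univ : Set ℂ))) E := by
    rintro _ ⟨m, G, hG, rfl⟩
    have hE := measurableSet_generateFrom_setOf_forall_mem G
    have h1 : Tendsto (fun n => (squareCrossingLaw (univ : Set ℂ) (δs n) :
        Measure (QuadConfig (univ : Set ℂ))) {S | ∀ i, G i ∈ S}) atTop
        (𝓝 ((μ : Measure (QuadConfig (univ : Set ℂ))) {S | ∀ i, G i ∈ S})) :=
      tendsto_measure_of_null_frontier_generateFrom isOpen_univ univ_nonempty hconv
        (finite_range G) (by rintro _ ⟨i, rfl⟩; exact hAμ _ (hG i)) hE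
    have h2 : Tendsto (fun n => (squareCrossingLaw (univ : Set ℂ) (k * δs n) :
        Measure (QuadConfig (univ : Set ℂ))) {S | ∀ i, G i ∈ S}) atTop
        (𝓝 ((ν : Measure (QuadConfig (univ : Set ℂ))) {S | ∀ i, G i ∈ S})) :=
      tendsto_measure_of_null_frontier_generateFrom isOpen_univ univ_nonempty hconvν
        (finite_range G) (by rintro _ ⟨i, rfl⟩; exact hAν _ (hG i)) hE
    have h1' := (ENNReal.tendsto_toReal (measure_ne_top _ _)).comp h1
    have h2' := (ENNReal.tendsto_toReal (measure_ne_top _ _)).comp h2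
    have h3 := (hdiff m G).comp hδs
    have h4 : Tendsto (fun n =>
        (squareCrossingLaw (univ : Set ℂ) (k * δs n) : Measure (QuadConfig (univ : Set ℂ))).real
            {S | ∀ i, G i ∈ S} -
          (squareCrossingLaw (univ : Set ℂ) (δs n) : Measure (QuadConfig (univ : Set ℂ))).real
            {S | ∀ i, G i ∈ S}) atTop
        (𝓝 (((ν : Measure (QuadConfig (univ : Set ℂ))) {S | ∀ i, G i ∈ S}).toReal -
          ((μ : Measure (QuadConfig (univ : Set ℂ))) {S | ∀ i, G i ∈ S}).toReal)) := by
      simp only [measureReal_def]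
      exact h2'.sub h1'
    have heq := tendsto_nhds_unique h4 h3
    rw [sub_eq_zero] at heq
    exact (ENNReal.toReal_eq_toReal_iff' (measure_ne_top _ _) (measure_ne_top _ _)).mp heq
  have hνμ : (ν : Measure (QuadConfig (univ : Set ℂ))) =
      (μ : Measure (QuadConfig (univ : Set ℂ))) :=
    ext_of_generate_finite C hgen hCpi hagree (by rw [measure_univ, measure_univ])
  exact FiniteMeasure.toMeasure_injective hνμ

/-! ### The route item -/

/-- **`LagsToInvariance` (item stmt-CriticalPhenomena-10273 of route CardySelfRefinement).**
`ExactEndpoints → LatticeLags → ∀ μ ∈ subseqQuadLimits univ, dilateLaw 2 μ = μ ∧ dilateLaw 3 μ = μ`: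
`ExactEndpoints` turns the lag statement about the interpolating laws `M_k(1,0)`, `M_k(0,½)` into
the `o(1)`-merging of the joint crossing probabilities of the bond-`ℤ²` laws at meshes `kη` and
`η` (`measureReal_preimage_configOf_eq_of_map_eq`), and `dilateLaw_eq_self_of_lags` concludes for
`k = 2, 3`. -/
theorem lagsToInvariance_proof : LagsToInvariance := by
  intro hEE hLags μ hμ
  have key : ∀ k : ℕ, k = 2 ∨ k = 3 → ∀ (m : ℕ) (G : Fin m → Quad (univ : Set ℂ)),
      Tendsto (fun η : ℝ =>
        (squareCrossingLaw (univ : Set ℂ) ((k : ℝ) * η) : Measure (QuadConfig (univ : Set ℂ))).real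
            {S | ∀ i, G i ∈ S} -
          (squareCrossingLaw (univ : Set ℂ) η : Measure (QuadConfig (univ : Set ℂ))).real
            {S | ∀ i, G i ∈ S}) (𝓝[>] 0) (𝓝 0) := by
    intro k hk m G
    have hkpos : (0 : ℝ) < k := by rcases hk with rfl | rfl <;> norm_num
    have hS := measurableSet_setOf_forall_mem G
    refine (hLags k hk m G).congr' ?_
    filter_upwards [self_mem_nhdsWithin] with η hη
    obtain ⟨h1, h2⟩ := hEE k hk η hη
    exact congrArg₂ (· - ·)
      (measureReal_preimage_configOf_eq_of_map_eq (mul_pos hkpos hη) h1 hS)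
      (measureReal_preimage_configOf_eq_of_map_eq hη h2 hS)
  have h2 := dilateLaw_eq_self_of_lags (k := ((2 : ℕ) : ℝ)) (by norm_num) (key 2 (Or.inl rfl)) hμ
  have h3 := dilateLaw_eq_self_of_lags (k := ((3 : ℕ) : ℝ)) (by norm_num) (key 3 (Or.inr rfl)) hμ
  simp only [Nat.cast_ofNat] at h2 h3
  exact ⟨h2, h3⟩

end Summit.CriticalPhenomena.CardyFormulaZ2.Theorems

end
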